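import Summits.BirchSwinnertonDyer.BirchSwinnertonDyer.Theorems.UniversalToricDescentRoadFFDescentOddRational
import Summits.BirchSwinnertonDyer.BirchSwinnertonDyer.Theorems.UniversalToricDescentRoadFFRationalDescentPerLevel
import HarnessLib

/-!
# Road FF descent kernel at odd `p` from a RATIONAL member tower with a PER-LEVEL exponent (`limsup (m − e_m) = ∞`),
# and ♭B's consequent for the 3-multiplicative twin with `k = μ(L·P_Σ)` (kernel brick N1, second half)

Width seat `bsd-wall-utd-p2-w2` (g3) for the LEAD of `stmt-BirchSwinnertonDyer-20694` / ♭B_T `stmt-BirchSwinnertonDyer-27172`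
(route `UniversalToricDescent`, line `membertower`; memo `Cruxes/TwinSplitIMCAtThreeMult/MEMBER-INCLUSION-AT3-g12.md` §2/§4).
`--supports stmt-BirchSwinnertonDyer-20694`. Nothing is booked; BSD is proved for no curve.

p616714 (`P2.RoadFF.map_span_C_pow_mul_fittingIdeal_le_of_rationalMemberTower_odd`) runs the Road-FF descent at odd `p`
from a rational member tower with ONE exponent `e` for all levels (`m`-uniform: atom K1b). Here every level `m` carries
ITS OWN exponent `e_m` and the tower is only asked to satisfy `limsup (m − e_m) = ∞`; the price is prime avoidance by
`p` in `R₀⟦T⟧` (p624691: `CongruenceDescent.span_pow_mul_le_span_of_forall_perLevel`), so the output is twisted by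
`C(p)^t` with `t = μ(L·P_Σ)` (`L·P_Σ = C(p)^t·L₀`, `C(p)` regular modulo `L₀`) instead of `C(p)^e`:

* `P2.RoadFF.map_span_C_pow_mul_fittingIdeal_le_of_rationalMemberTower_odd_perLevel` — the kernel (same wiring as
  p616714: (F1), (SelBC) + (Frob), (b) + Lemma 2.1 via `nonempty_memberCongruence_odd_of_facts`; receptacles
  `(R₀ ⊗ 𝒪_m)⟦T⟧`; the per-level limit of p624691 at the end).
* `twin_exists_wanFrame_of_sigmaData_of_rationalMemberTower_perLevel` — at the 3-multiplicative twin: ♭B's consequent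
  VERBATIM with `k = t = μ(L·P_Σ)` (`CongruenceDescent.exists_eq_C_pow_mul_regular_unrSeries` + the twisted recombination
  `AcSelmer.XAc.forall_C_pow_mul_mem_span_of_map_span_mul_fittingIdeal_le`), and `…_of_isUnit_coeff` — `k = 0` when
  `μ(L·P_Σ) = 0`.

References: [Castella2018Erratum] (b), (c), Lemma 2.1, (2.5), proof of Thm. 1.1 (pp. 2–4); [Skinner2016PacificMC] §2.3,
§2.6 (2-6-1), §3.1 (p. 192); [SkinnerUrban2014] Prop. 3.2.3, Lemma 3.1.9; [YanZhu2026] Cor. 4.6; [StacksProject] Tag 05GI.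
-/

set_option autoImplicit false

noncomputable section

open scoped TensorProduct Classical

open CategoryTheory PowerSeries NumberField IsDedekindDomain Field WeierstrassCurve
open Literature.NumberTheory.GaloisRepresentations Literature.NumberTheory.EllipticCurves
  Literature.NumberTheory.EllipticCurves.BigGaloisRep Literature.NumberTheory.EllipticCurves.GreenbergSelmer
  Literature.NumberTheory.EllipticCurves.Skinner2016 Literature.NumberTheory.EllipticCurves.Rank1Residual
  Literature.NumberTheory.EllipticCurves.Rank1Residual.Typed Literature.NumberTheory.EllipticCurves.ModularForms
  Literature.NumberTheory.EllipticCurves.Castella2018 Literature.RingTheory.FittingIdeal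
open Summit.BirchSwinnertonDyer.Rank1Residual.X11b.Halves Summit.BirchSwinnertonDyer.Rank1Residual.X11b.AcSelmer

namespace Summit.BirchSwinnertonDyer.Rank1Residual.X11b

open RoadFFMember Summit.BirchSwinnertonDyer.BirchSwinnertonDyer.Theorems

/-! ### §1 The descent kernel at odd `p` from a RATIONAL member tower with a PER-LEVEL exponent -/

-- Same elaboration profile as p616714 (five `ℕ`-indexed families unified with the feeder's binders): 800 000 heartbeats.
set_option maxHeartbeats 800000 in
/-- **ROAD FF DESCENT KERNEL AT ANY ODD PRIME FROM A RATIONAL MEMBER TOWER WITH A PER-LEVEL EXPONENT.** For a globally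
minimal `E/ℚ`, `p ≥ 3` with `E[p]` irreducible and `p ∥ N`, `K` imaginary quadratic with `p` split, the X-slot `𝔭bar ∋ p`,
(dec) `E(ℚ_p)[p] = 0`, ANY `L ∈ R₀⟦T⟧` with a factorisation `L·P_Σ = C(p)^t·L₀`, `C(p)` regular modulo `L₀`
(always available with `t = μ(L·P_Σ)`: `CongruenceDescent.exists_eq_C_pow_mul_regular_unrSeries`), exponents
`e : ℕ → ℕ` with `m − e_m` unbounded, and for every `m ≥ 1` a Hida member `g_m` [Ski16 §2.6] whose `Σ`-imprimitive Selmer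
dual satisfies, in every receptacle `S₀`, the RATIONAL one-sided inclusion UNDER the torsion premise
«`(p^{e_m} · Ch(X^Σ_ac(A_{g_m})))·S₀⟦T⟧ ⊆ (L_m)`» and (c) «`(L_m) ⊆ (L·P_Σ) + (p^m)`»: then
`(C(p)^t · Fitt₀_Λ(X^Σ_ac(E; slot 𝔭bar)))·R₀⟦T⟧ ⊆ (L·P_Σ)`. Wiring = p616714 verbatim; the limit is the per-level one of
p624691 (`AcSelmer.XAc.map_span_C_pow_mul_fittingIdeal_le_span_of_oneSided_congruences_descent_le_printed_perLevel`).
CONDITIONAL on Shapiro `hSh` (PUBLISHED) and on the rational member tower (RESEARCH); nothing is booked; BSD is proved for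
no curve. [cite: Castella2018Erratum, (b), (c), Lemma 2.1, (2.5) and proof of Thm. 1.1 (pp. 2–4)]
[cite: Skinner2016PacificMC, §2.3 (p. 179), §2.6 (2-6-1), §3.1 (p. 192)] [cite: SkinnerUrban2014, Prop. 3.2.3, Lemma 3.1.9]
[cite: YanZhu2026, Cor. 4.6 (the `S⁻¹`-shape of the member inclusion)] [cite: StacksProject, Tag 05GI] -/
theorem P2.RoadFF.map_span_C_pow_mul_fittingIdeal_le_of_rationalMemberTower_odd_perLevel
    (hSh : SkinnerUrban2014.prop323_XAc_equiv_XBigDecomp)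
    (W : WeierstrassCurve ℚ) [W.IsElliptic] [W.IsGloballyMinimal] (p : ℕ) [Fact p.Prime] (hp : 3 ≤ p)
    (K : Type) [Field K] [NumberField K] (hK : IsImaginaryQuadratic K) (hirr : Irr W p) (hmult : Mult W p)
    (hsp : SplitsIn K p) (hiv : ∀ Q : (W.baseChange ℚ_[p]).toAffine.Point, p • Q = 0 → Q = 0)
    (κ : ZpExtension K p) (hκ : κ.IsAnticyclotomic) (γ : Field.absoluteGaloisGroup K) [Fact (κ.IsTopGenerator γ)]
    (𝔭bar : HeightOneSpectrum (𝓞 K)) (h𝔭bar : ((p : ℕ) : 𝓞 K) ∈ 𝔭bar.asIdeal)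
    (L : UnrSeries p) {t : ℕ} {L₀ : UnrSeries p}
    (hLS : L * PowerSeries.map (toUnr p) (W.sigmaEulerElement p K κ) =
      (C ((p : ℕ) : unrIntegers p) : UnrSeries p) ^ t * L₀)
    (hreg : ∀ y : UnrSeries p, (C ((p : ℕ) : unrIntegers p) : UnrSeries p) * y ∈ Ideal.span {L₀} →
      y ∈ Ideal.span {L₀})
    (e : ℕ → ℕ) (hunb : ∀ n : ℕ, ∃ m : ℕ, 1 ≤ m ∧ n + e m ≤ m)
    (hmem : ∀ m : ℕ, 1 ≤ m →
      ∃ D : Skinner2016.HidaCongruentMember W p m,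
        ∀ [TopologicalSpace (PowerSeries (padicCoeffIntegers D.ι))]
          [ContinuousSMul (PowerSeries (padicCoeffIntegers D.ι))
            (BigRepModule (padicCoeffIntegers D.ι) p (Cofree D.Δ.ρ (padicCoeffField D.ι)))],
        ∀ (S₀ : Type) [CommRing S₀] (a : unrIntegers p →+* S₀) (b : padicCoeffIntegers D.ι →+* S₀)
          (j : ℤ_[p] →+* unrIntegers p),
          (∀ x : ℤ_[p], ((j x : unrIntegers p) : ℂ_[p]) = algebraMap ℚ_[p] ℂ_[p] (x : ℚ_[p])) →
          a.comp j = b.comp (algebraMap ℤ_[p] (padicCoeffIntegers D.ι)) →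
          ∃ Lm : PowerSeries S₀,
            (Module.IsTorsion (PowerSeries (padicCoeffIntegers D.ι))
                (XBig κ (D.Δ.cofreeRepOver K) 𝔭bar (↑(W.sigmaPlacesFinset p K))) →
              Ideal.span {((p : ℕ) : PowerSeries S₀) ^ e m} *
                  (XBig.charIdeal κ (D.Δ.cofreeRepOver K) 𝔭bar (↑(W.sigmaPlacesFinset p K))).map
                    (PowerSeries.map b) ≤ Ideal.span {Lm}) ∧
            Ideal.span {Lm} ≤
              Ideal.span {PowerSeries.map a (L * PowerSeries.map j (W.sigmaEulerElement p K κ))} ⊔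
                Ideal.span {((p : ℕ) : PowerSeries S₀) ^ m}) :
    (Ideal.span {(PowerSeries.C (p : ℤ_[p]) : IwasawaAlgebra p) ^ t} *
        Module.fittingIdeal (IwasawaAlgebra p)
          (AcSelmer.XAc (W.baseChange K) p κ 𝔭bar
            (↑(W.sigmaPlacesFinset p K) : Set (HeightOneSpectrum (𝓞 K))) γ) 0).map (PowerSeries.map (toUnr p)) ≤
      Ideal.span {L * PowerSeries.map (toUnr p) (W.sigmaEulerElement p K κ)} := by
  -- ### elementary consequences of the binders
  have hpN : p ∣ W.conductorNorm ℤ := dvd_conductorNorm_of_mult hmult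
  have hN0 : W.conductorNorm ℤ ≠ 0 := (W.conductorNorm_pos_holds).ne'
  have hpM : ¬ p ∣ W.conductorNorm ℤ / p := by
    have hfac := W.factorization_conductorNorm_eq_one_of_hasMultiplicativeReductionAtPrime p hmult
    intro h
    have h2 : p ^ 2 ∣ W.conductorNorm ℤ := by
      rw [pow_two]
      exact Nat.mul_dvd_of_dvd_div hpN h
    have := ((Fact.out : p.Prime).pow_dvd_iff_le_factorization hN0).mp h2
    omega
  have hMpos : 0 < W.conductorNorm ℤ / p :=
    Nat.div_pos (Nat.le_of_dvd (Nat.pos_of_ne_zero hN0) hpN) (Fact.out : p.Prime).pos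
  haveI : NeZero (W.conductorNorm ℤ / p) := ⟨hMpos.ne'⟩
  have hHp : SatisfiesHeegnerHypothesis p K := satisfiesHeegnerHypothesis_of_splitsIn Fact.out hsp
  -- ### `Σ`
  have hSfin : (↑(W.sigmaPlacesFinset p K) : Set (HeightOneSpectrum (𝓞 K))).Finite :=
    (W.sigmaPlacesFinset p K).finite_toSet
  have hSp : ∀ w ∈ (↑(W.sigmaPlacesFinset p K) : Set (HeightOneSpectrum (𝓞 K))),
      ((p : ℕ) : 𝓞 K) ∉ w.asIdeal :=
    fun w hw => W.forall_mem_sigmaPlacesFinset_not_mem p K w (Finset.mem_coe.1 hw)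
  have hS : ∀ w : HeightOneSpectrum (𝓞 K), w ∉ (↑(W.sigmaPlacesFinset p K) : Set (HeightOneSpectrum (𝓞 K))) →
      ((p : ℕ) : 𝓞 K) ∉ w.asIdeal → (W.baseChange K).HasGoodReductionAt w := by
    intro w hw hwp
    rw [WeierstrassCurve.coe_sigmaPlacesFinset] at hw
    exact WeierstrassCurve.hasGoodReductionAt_baseChange_of_not_mem_sigmaPlaces hw hwp
  have hSM : ∀ w : HeightOneSpectrum (𝓞 K), w ∉ (↑(W.sigmaPlacesFinset p K) : Set (HeightOneSpectrum (𝓞 K))) →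
      ((W.conductorNorm ℤ / p : ℕ) : 𝓞 K) ∉ w.asIdeal := by
    intro w hw hM'
    rw [WeierstrassCurve.coe_sigmaPlacesFinset] at hw
    exact hw (WeierstrassCurve.mem_sigmaPlaces_of_tameLevel_mem hpN hpM hM')
  -- ### `K_{𝔭bar} → ℚ_p`
  obtain ⟨heb, hfb⟩ := degreeOne_of_splitsIn hK.1 hsp h𝔭bar
  obtain ⟨φ⟩ := AcSelmer.exists_ringHom_adicCompletion_padic_of_degreeOne p 𝔭bar h𝔭bar heb hfb
  -- ### a member at every level `max m 1`, with its own exponent `e (max m 1)`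
  choose Dm hDm using fun m : ℕ => hmem (max m 1) (le_max_right m 1)
  -- ### the unboundedness of `m − e_m` in the re-indexed form
  have hunb' : ∀ n : ℕ, ∃ m : ℕ, 1 ≤ m ∧ n + e (max m 1) ≤ m := by
    intro n
    obtain ⟨m, hm1, hmn⟩ := hunb n
    exact ⟨m, hm1, by rwa [max_eq_left hm1]⟩
  -- ### topologies and coefficient-ring instances
  letI : TopologicalSpace (IwasawaAlgebra p) := ⊥
  haveI : DiscreteTopology (IwasawaAlgebra p) := ⟨rfl⟩
  letI τ : ∀ m : ℕ, TopologicalSpace (PowerSeries (padicCoeffIntegers (Dm m).ι)) := fun _ => ⊥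
  haveI : ∀ m : ℕ, DiscreteTopology (PowerSeries (padicCoeffIntegers (Dm m).ι)) := fun _ => ⟨rfl⟩
  haveI : ∀ m : ℕ, IsPrincipalIdealRing (padicCoeffIntegers (Dm m).ι) := fun m =>
    (Dm m).isPrincipalIdealRing_coeffRing
  haveI : ∀ m : ℕ, Module.Free ℤ_[p] (padicCoeffIntegers (Dm m).ι) := fun m => (Dm m).moduleFree_coeffRing
  haveI : ∀ m : ℕ, Module.Finite ℤ_[p] (padicCoeffIntegers (Dm m).ι) := fun m =>
    (Dm m).moduleFinite_coeffRing
  letI : Algebra ℤ_[p] (unrIntegers p) := (toUnr p).toAlgebra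
  have hj : algebraMap ℤ_[p] (unrIntegers p) = toUnr p := rfl
  haveI : ∀ m : ℕ, Module.FaithfullyFlat (UnrSeries p)
      (PowerSeries (unrIntegers p ⊗[ℤ_[p]] padicCoeffIntegers (Dm m).ι)) := fun m =>
    faithfullyFlat_receptacle p (padicCoeffIntegers (Dm m).ι)
  -- the receptacle clause of every member: the RATIONAL (2.5)_m with exponent `e (max m 1)` under the torsion premise, and (c)
  have hrec : ∀ m : ℕ, ∃ Lm : PowerSeries (unrIntegers p ⊗[ℤ_[p]] padicCoeffIntegers (Dm m).ι),
      (Module.IsTorsion (PowerSeries (padicCoeffIntegers (Dm m).ι))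
          (XBig κ ((Dm m).Δ.cofreeRepOver K) 𝔭bar (↑(W.sigmaPlacesFinset p K) : Set (HeightOneSpectrum (𝓞 K)))) →
        Ideal.span {((p : ℕ) : PowerSeries (unrIntegers p ⊗[ℤ_[p]] padicCoeffIntegers (Dm m).ι)) ^ e (max m 1)} *
          (XBig.charIdeal κ ((Dm m).Δ.cofreeRepOver K) 𝔭bar
            (↑(W.sigmaPlacesFinset p K) : Set (HeightOneSpectrum (𝓞 K)))).map
            (PowerSeries.map (Algebra.TensorProduct.includeRight (R := ℤ_[p]) (A := unrIntegers p)
              (B := padicCoeffIntegers (Dm m).ι)).toRingHom) ≤ Ideal.span {Lm}) ∧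
        Ideal.span {Lm} ≤
          Ideal.span {PowerSeries.map (algebraMap (unrIntegers p)
              (unrIntegers p ⊗[ℤ_[p]] padicCoeffIntegers (Dm m).ι))
              (L * PowerSeries.map (toUnr p) (W.sigmaEulerElement p K κ))} ⊔
            Ideal.span {((p : ℕ) : PowerSeries (unrIntegers p ⊗[ℤ_[p]] padicCoeffIntegers (Dm m).ι)) ^
              (max m 1)} :=
    fun m => hDm m _ (algebraMap _ _) _ (toUnr p) (coe_toUnr p)
      (algebraMap_comp_toUnr_eq p (padicCoeffIntegers (Dm m).ι) hj)
  choose Lm hLm using hrec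
  -- finite generation of `X^Σ_ac(A_{g_m})` over `Λ_{𝒪_m}`
  haveI : ∀ m : ℕ, Module.Finite (PowerSeries (padicCoeffIntegers (Dm m).ι))
      (XBig κ ((Dm m).Δ.cofreeRepOver K) 𝔭bar (↑(W.sigmaPlacesFinset p K) : Set (HeightOneSpectrum (𝓞 K)))) :=
    fun m =>
      haveI := (Dm m).finiteDimensional_padicCoeffField
      SkinnerUrban2014.moduleFinite_XBig_of_lemma319 SkinnerUrban2014.lemma319_finite_XBig_holds κ 𝔭bar _ hSfin
        ((Dm m).Δ.cofreeRepOver K)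
        (GreenbergSelmer.Cofree.exists_pow_psmul_eq_zero (Dm m).ι (Dm m).Δ.ρ)
        (GreenbergSelmer.Cofree.divisible (padicCoeffField (Dm m).ι) (Dm m).Δ.ρ (Fact.out : p.Prime).ne_zero)
        (GreenbergSelmer.Cofree.finite_setOf_psmul_eq_zero (Dm m).ι (Dm m).Δ.ρ)
        (GreenbergSelmer.OrdinaryNewformDatum.cofreeRepOver_localMap_inr_apply_eq_self (Dm m).Δ K _ hSM)
  -- ### the member congruences `e_m` at `3 ≤ p`
  have hEm : ∀ m : ℕ, 1 ≤ m →
      Nonempty ((((PowerSeries (padicCoeffIntegers (Dm m).ι)) ⊗[IwasawaAlgebra p]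
            AcSelmer.XAc (W.baseChange K) p κ 𝔭bar (↑(W.sigmaPlacesFinset p K) : Set (HeightOneSpectrum (𝓞 K))) γ) ⧸
          (((Ideal.span {(C (p : ℤ_[p]) : IwasawaAlgebra p)}).map
              (algebraMap (IwasawaAlgebra p) (PowerSeries (padicCoeffIntegers (Dm m).ι)))) ^ m •
            (⊤ : Submodule (PowerSeries (padicCoeffIntegers (Dm m).ι))
              ((PowerSeries (padicCoeffIntegers (Dm m).ι)) ⊗[IwasawaAlgebra p]
                AcSelmer.XAc (W.baseChange K) p κ 𝔭bar (↑(W.sigmaPlacesFinset p K) : Set (HeightOneSpectrum (𝓞 K))) γ))))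
          ≃ₗ[PowerSeries (padicCoeffIntegers (Dm m).ι)]
        (XBig κ ((Dm m).Δ.cofreeRepOver K) 𝔭bar (↑(W.sigmaPlacesFinset p K) : Set (HeightOneSpectrum (𝓞 K))) ⧸
          (((Ideal.span {(C (p : ℤ_[p]) : IwasawaAlgebra p)}).map
              (algebraMap (IwasawaAlgebra p) (PowerSeries (padicCoeffIntegers (Dm m).ι)))) ^ m •
            (⊤ : Submodule (PowerSeries (padicCoeffIntegers (Dm m).ι))
              (XBig κ ((Dm m).Δ.cofreeRepOver K) 𝔭bar (↑(W.sigmaPlacesFinset p K) : Set (HeightOneSpectrum (𝓞 K)))))))) := by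
    intro m hm
    exact nonempty_quotPow_congr_of_eq _ (max_eq_left hm)
      (nonempty_memberCongruence_odd_of_facts hSh Skinner2016.selmerBig_extendScalars_equiv_baseChange_holds hp
        hirr hK hHp 𝔭bar h𝔭bar φ hiv _ hSfin hSp hS hSM κ hκ γ (Dm m) (le_max_right m 1)).some
  -- ### the per-level twisting element `C(p)^{e_m}` and its image `p^{e_m}` in every receptacle
  have hCp : (PowerSeries.C (p : ℤ_[p]) : IwasawaAlgebra p) = ((p : ℕ) : IwasawaAlgebra p) := map_natCast _ p
  have htw : ∀ m : ℕ,
      (PowerSeries.map (Algebra.TensorProduct.includeRight (R := ℤ_[p]) (A := unrIntegers p)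
          (B := padicCoeffIntegers (Dm m).ι)).toRingHom)
        (algebraMap (IwasawaAlgebra p) (PowerSeries (padicCoeffIntegers (Dm m).ι))
          ((PowerSeries.C (p : ℤ_[p]) : IwasawaAlgebra p) ^ e (max m 1))) =
      ((p : ℕ) : PowerSeries (unrIntegers p ⊗[ℤ_[p]] padicCoeffIntegers (Dm m).ι)) ^ e (max m 1) := by
    intro m
    rw [hCp, map_pow, map_pow, map_natCast, map_natCast]
  -- ### (c), one-sided, with `(p^m)` in the consumer's spelling
  have hc' : ∀ m : ℕ, 1 ≤ m →
      Ideal.span {Lm m} ≤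
        Ideal.span {algebraMap (UnrSeries p) (PowerSeries (unrIntegers p ⊗[ℤ_[p]] padicCoeffIntegers (Dm m).ι))
            (L * PowerSeries.map (toUnr p) (W.sigmaEulerElement p K κ))} ⊔
          (((Ideal.span {(C (p : ℤ_[p]) : IwasawaAlgebra p)}).map (PowerSeries.map (toUnr p))).map
            (algebraMap (UnrSeries p) (PowerSeries (unrIntegers p ⊗[ℤ_[p]] padicCoeffIntegers (Dm m).ι)))) ^ m :=
    fun m hm => span_le_sup_of_receptacle p (padicCoeffIntegers (Dm m).ι) hm _ (Lm m) (hLm m).2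
  -- ### the per-level twisted Fitting-level member limit (prime avoidance by `p` in `R₀⟦T⟧`, Krull along `m − e_m → ∞`)
  refine AcSelmer.XAc.map_span_C_pow_mul_fittingIdeal_le_span_of_oneSided_congruences_descent_le_printed_perLevel
    (W.baseChange K) p κ 𝔭bar γ hSfin (fun m => e (max m 1)) hunb'
    (L * PowerSeries.map (toUnr p) (W.sigmaEulerElement p K κ)) hLS hreg
    (fun m => PowerSeries (padicCoeffIntegers (Dm m).ι))
    (fun m => PowerSeries (unrIntegers p ⊗[ℤ_[p]] padicCoeffIntegers (Dm m).ι))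
    (fun m => PowerSeries.map (Algebra.TensorProduct.includeRight (R := ℤ_[p]) (A := unrIntegers p)
      (B := padicCoeffIntegers (Dm m).ι)).toRingHom)
    (fun m => map_includeRight_comp_algebraMap p (padicCoeffIntegers (Dm m).ι) hj)
    (fun m => XBig κ ((Dm m).Δ.cofreeRepOver K) 𝔭bar (↑(W.sigmaPlacesFinset p K) : Set (HeightOneSpectrum (𝓞 K))))
    Lm (fun m hm => (hEm m hm).some)
    ?_ hc'
  intro m _ hTm
  have hI := congrArg (fun x : PowerSeries (unrIntegers p ⊗[ℤ_[p]] padicCoeffIntegers (Dm m).ι) =>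
    Ideal.span ({x} : Set (PowerSeries (unrIntegers p ⊗[ℤ_[p]] padicCoeffIntegers (Dm m).ι)))) (htw m)
  exact (congrArg (· * _) hI).trans_le ((hLm m).1 hTm)

/-! ### §2 At the 3-multiplicative twin: ♭B's consequent with `k = μ(L·P_Σ)` from a rational PER-LEVEL member tower -/

/-- **RATIONAL PER-LEVEL MEMBER TOWER + `Σ`-DATA ⟹ THE RATIONAL WAN FRAME OF THE 3-MULTIPLICATIVE TWIN, `k = μ(L·P_Σ)`.**
Under the binders of ♭B / `stub_wanFrameMult` plus (dec) `W′(ℚ₃)[3] = 0`: a frame `(Ω_K ≠ 0, Ω_p ≠ 0, L)` of `f` at the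
frame prime `𝔭` (ANY non-zero `Ω_p ∈ ℂ₃`), the twin's `Σ`-data at the X-slot `𝔭'`, exponents `e : ℕ → ℕ` with `m − e_m`
unbounded and a Hida member tower of `W′` at `p = 3` with the RATIONAL inclusions «torsion → `(3^{e_m}·Ch)·S₀⟦T⟧ ⊆ (L_m)`»
and (c) — give VERBATIM the consequent of the crux ♭B `TwinWanFrameAtThreeMult` at the datum, witnessed with
`k = μ(L·P_Σ)` (§1 at the canonical factorisation `CongruenceDescent.exists_eq_C_pow_mul_regular_unrSeries` + the twisted
recombination `AcSelmer.XAc.forall_C_pow_mul_mem_span_of_map_span_mul_fittingIdeal_le`). The `m`-uniform case is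
p616714's `twin_exists_wanFrame_of_sigmaData_of_rationalMemberTower` (`k = e`). CONDITIONAL on Shapiro `hSh` (PUBLISHED),
the rational member tower (RESEARCH), the `Σ`-data and (dec); nothing is booked; BSD is proved for no curve.
[cite: Castella2018Erratum, proof of Thm. 1.1 (p. 4), read one-sidedly] [cite: Skinner2016PacificMC, §3.1 (p. 192)]
[cite: SkinnerUrban2014, Prop. 3.2.3] [cite: YanZhu2026, Cor. 4.6] -/
theorem twin_exists_wanFrame_of_sigmaData_of_rationalMemberTower_perLevel
    (hSh : SkinnerUrban2014.prop323_XAc_equiv_XBigDecomp)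
    (W' : WeierstrassCurve ℚ) [W'.IsElliptic] [W'.IsGloballyMinimal] (N' : ℕ)
    (K : Type) [Field K] [NumberField K]
    (hm : Mult W' 3) (hsurj : W'.HasSurjectiveModNGaloisRep 3) (hN : W'.conductorNorm ℤ = N')
    (hK : IsImaginaryQuadratic K) (hH : SatisfiesHeegnerHypothesis N' K)
    (κ : ZpExtension K 3) (hκ : κ.IsAnticyclotomic) (γ : Field.absoluteGaloisGroup K) [Fact (κ.IsTopGenerator γ)]
    (𝔭 𝔭' : HeightOneSpectrum (𝓞 K)) (h𝔭' : ((3 : ℕ) : 𝓞 K) ∈ 𝔭'.asIdeal) (ι' : PadicAlgCl 3 ≃+* ℂ)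
    {M : ℕ} (f : CuspForm (CongruenceSubgroup.Gamma0 M) 2)
    (hiv : ∀ Q : (W'.baseChange ℚ_[3]).toAffine.Point, 3 • Q = 0 → Q = 0)
    (hSD : P2.RoadFF.SigmaDataAt W' 3 κ 𝔭' γ (↑(W'.sigmaPlacesFinset 3 K) : Set (HeightOneSpectrum (𝓞 K)))
      (W'.sigmaEulerElement 3 K κ))
    {ΩK : ℂ} {Ωp : ℂ_[3]} {L : UnrSeries 3} (hΩ : ΩK ≠ 0) (hΩp : Ωp ≠ 0)
    (hL : IsBDPLFunction ι' 𝔭 κ γ f ΩK Ωp L) (e : ℕ → ℕ) (hunb : ∀ n : ℕ, ∃ m : ℕ, 1 ≤ m ∧ n + e m ≤ m)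
    (hmem : ∀ m : ℕ, 1 ≤ m →
      ∃ D : Skinner2016.HidaCongruentMember W' 3 m,
        ∀ [TopologicalSpace (PowerSeries (padicCoeffIntegers D.ι))]
          [ContinuousSMul (PowerSeries (padicCoeffIntegers D.ι))
            (BigRepModule (padicCoeffIntegers D.ι) 3 (Cofree D.Δ.ρ (padicCoeffField D.ι)))],
        ∀ (S₀ : Type) [CommRing S₀] (a : unrIntegers 3 →+* S₀) (b : padicCoeffIntegers D.ι →+* S₀)
          (j : ℤ_[3] →+* unrIntegers 3),
          (∀ x : ℤ_[3], ((j x : unrIntegers 3) : ℂ_[3]) = algebraMap ℚ_[3] ℂ_[3] (x : ℚ_[3])) →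
          a.comp j = b.comp (algebraMap ℤ_[3] (padicCoeffIntegers D.ι)) →
          ∃ Lm : PowerSeries S₀,
            (Module.IsTorsion (PowerSeries (padicCoeffIntegers D.ι))
                (XBig κ (D.Δ.cofreeRepOver K) 𝔭' (↑(W'.sigmaPlacesFinset 3 K))) →
              Ideal.span {((3 : ℕ) : PowerSeries S₀) ^ e m} *
                  (XBig.charIdeal κ (D.Δ.cofreeRepOver K) 𝔭' (↑(W'.sigmaPlacesFinset 3 K))).map
                    (PowerSeries.map b) ≤ Ideal.span {Lm}) ∧
            Ideal.span {Lm} ≤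
              Ideal.span {PowerSeries.map a (L * PowerSeries.map j (W'.sigmaEulerElement 3 K κ))} ⊔
                Ideal.span {((3 : ℕ) : PowerSeries S₀) ^ m}) :
    ∃ (ΩK : ℂ) (Ωp : ℂ_[3]) (L : UnrSeries 3), ΩK ≠ 0 ∧ Ωp ≠ 0 ∧
      IsBDPLFunction ι' 𝔭 κ γ f ΩK Ωp L ∧
      ∃ k : ℕ, ∀ G ∈ (AcSelmer.XAc.charIdeal (W'.baseChange K) 3 κ 𝔭' ∅ γ).map
        (PowerSeries.map (toUnr 3)), PowerSeries.C (((3 : ℕ) : unrIntegers 3) ^ k) * G ∈ Ideal.span {L} := by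
  have hirr : Irr W' 3 := hasIrreducibleModPGaloisRep_of_hasSurjectiveModNGaloisRep W' 3 hsurj
  have hsp : SplitsIn K 3 := hH 3 Nat.prime_three (hN ▸ dvd_conductorNorm_of_mult hm)
  obtain ⟨t, L₀, hLS, hreg⟩ := CongruenceDescent.exists_eq_C_pow_mul_regular_unrSeries
    (L * PowerSeries.map (toUnr 3) (W'.sigmaEulerElement 3 K κ))
  have key := P2.RoadFF.map_span_C_pow_mul_fittingIdeal_le_of_rationalMemberTower_odd_perLevel hSh W' 3 le_rfl K hK
    hirr hm hsp hiv κ hκ γ 𝔭' h𝔭' L hLS hreg e hunb hmem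
  obtain ⟨hSfin, hT, hPS, hX⟩ := hSD
  exact ⟨ΩK, Ωp, L, hΩ, hΩp, hL, t,
    AcSelmer.XAc.forall_C_pow_mul_mem_span_of_map_span_mul_fittingIdeal_le (W'.baseChange K) 3 κ 𝔭' γ hSfin hT t
      key hPS hX (dvd_refl _)⟩

/-- **The same with `k = 0` when `μ(L·P_Σ) = 0`** (a unit coefficient of `L·P_Σ`: then `C(3)` is regular modulo `L·P_Σ`
itself, `CongruenceDescent.regular_C_p_of_isUnit_coeff_unrSeries`, and §1 runs with `t = 0`). CONDITIONAL as above.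
[cite: Castella2018Erratum, proof of Thm. 1.1 (p. 4), read one-sidedly] [cite: Skinner2016PacificMC, §3.1 (p. 192)] -/
theorem twin_forall_mem_span_of_sigmaData_of_rationalMemberTower_perLevel_of_isUnit_coeff
    (hSh : SkinnerUrban2014.prop323_XAc_equiv_XBigDecomp)
    (W' : WeierstrassCurve ℚ) [W'.IsElliptic] [W'.IsGloballyMinimal] (N' : ℕ)
    (K : Type) [Field K] [NumberField K]
    (hm : Mult W' 3) (hsurj : W'.HasSurjectiveModNGaloisRep 3) (hN : W'.conductorNorm ℤ = N')
    (hK : IsImaginaryQuadratic K) (hH : SatisfiesHeegnerHypothesis N' K)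
    (κ : ZpExtension K 3) (hκ : κ.IsAnticyclotomic) (γ : Field.absoluteGaloisGroup K) [Fact (κ.IsTopGenerator γ)]
    (𝔭' : HeightOneSpectrum (𝓞 K)) (h𝔭' : ((3 : ℕ) : 𝓞 K) ∈ 𝔭'.asIdeal)
    (hiv : ∀ Q : (W'.baseChange ℚ_[3]).toAffine.Point, 3 • Q = 0 → Q = 0)
    (hSD : P2.RoadFF.SigmaDataAt W' 3 κ 𝔭' γ (↑(W'.sigmaPlacesFinset 3 K) : Set (HeightOneSpectrum (𝓞 K)))
      (W'.sigmaEulerElement 3 K κ))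
    (L : UnrSeries 3)
    (hμ : ∃ i : ℕ, IsUnit (PowerSeries.coeff i (L * PowerSeries.map (toUnr 3) (W'.sigmaEulerElement 3 K κ))))
    (e : ℕ → ℕ) (hunb : ∀ n : ℕ, ∃ m : ℕ, 1 ≤ m ∧ n + e m ≤ m)
    (hmem : ∀ m : ℕ, 1 ≤ m →
      ∃ D : Skinner2016.HidaCongruentMember W' 3 m,
        ∀ [TopologicalSpace (PowerSeries (padicCoeffIntegers D.ι))]
          [ContinuousSMul (PowerSeries (padicCoeffIntegers D.ι))
            (BigRepModule (padicCoeffIntegers D.ι) 3 (Cofree D.Δ.ρ (padicCoeffField D.ι)))],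
        ∀ (S₀ : Type) [CommRing S₀] (a : unrIntegers 3 →+* S₀) (b : padicCoeffIntegers D.ι →+* S₀)
          (j : ℤ_[3] →+* unrIntegers 3),
          (∀ x : ℤ_[3], ((j x : unrIntegers 3) : ℂ_[3]) = algebraMap ℚ_[3] ℂ_[3] (x : ℚ_[3])) →
          a.comp j = b.comp (algebraMap ℤ_[3] (padicCoeffIntegers D.ι)) →
          ∃ Lm : PowerSeries S₀,
            (Module.IsTorsion (PowerSeries (padicCoeffIntegers D.ι))
                (XBig κ (D.Δ.cofreeRepOver K) 𝔭' (↑(W'.sigmaPlacesFinset 3 K))) →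
              Ideal.span {((3 : ℕ) : PowerSeries S₀) ^ e m} *
                  (XBig.charIdeal κ (D.Δ.cofreeRepOver K) 𝔭' (↑(W'.sigmaPlacesFinset 3 K))).map
                    (PowerSeries.map b) ≤ Ideal.span {Lm}) ∧
            Ideal.span {Lm} ≤
              Ideal.span {PowerSeries.map a (L * PowerSeries.map j (W'.sigmaEulerElement 3 K κ))} ⊔
                Ideal.span {((3 : ℕ) : PowerSeries S₀) ^ m}) :
    ∀ G ∈ (AcSelmer.XAc.charIdeal (W'.baseChange K) 3 κ 𝔭' ∅ γ).map (PowerSeries.map (toUnr 3)),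
      G ∈ Ideal.span {L} := by
  have hirr : Irr W' 3 := hasIrreducibleModPGaloisRep_of_hasSurjectiveModNGaloisRep W' 3 hsurj
  have hsp : SplitsIn K 3 := hH 3 Nat.prime_three (hN ▸ dvd_conductorNorm_of_mult hm)
  have hreg := CongruenceDescent.regular_C_p_of_isUnit_coeff_unrSeries hμ
  have hLS : L * PowerSeries.map (toUnr 3) (W'.sigmaEulerElement 3 K κ) =
      (C ((3 : ℕ) : unrIntegers 3) : UnrSeries 3) ^ 0 * (L * PowerSeries.map (toUnr 3) (W'.sigmaEulerElement 3 K κ)) := by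
    rw [pow_zero, one_mul]
  have key := P2.RoadFF.map_span_C_pow_mul_fittingIdeal_le_of_rationalMemberTower_odd_perLevel hSh W' 3 le_rfl K hK
    hirr hm hsp hiv κ hκ γ 𝔭' h𝔭' L hLS hreg e hunb hmem
  obtain ⟨hSfin, hT, hPS, hX⟩ := hSD
  intro G hG
  have h := AcSelmer.XAc.forall_C_pow_mul_mem_span_of_map_span_mul_fittingIdeal_le (W'.baseChange K) 3 κ 𝔭' γ hSfin
    hT 0 key hPS hX (dvd_refl _) G hG
  rwa [pow_zero, map_one, one_mul] at h

end Summit.BirchSwinnertonDyer.Rank1Residual.X11b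

end
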